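import Summits.HodgeConjecture.HodgeConjecture.Theorems.NikulinTwinTransportRealMultiplicationAnchorOfAlgebraic
import Summits.HodgeConjecture.HodgeConjecture.Theorems.TwinTwistorTransport.Negative.WithoutRationalityOrHalving

/-!
# `TwinTransportRMPicardTwo` (stmt-HodgeConjecture-15067) · Negative · the rationality clause (eR)
# of the `e`-block carries the whole real-multiplication content

Negative knowledge for the crux `TwinTransportRMPicardTwo` (route NikulinTwinTransport r3, the
judge's milestone "the transport crux on the maximal RM-√2 families of Picard rank 2"): its
hypotheses single out the surfaces `S` by an endomorphism `e` of `H²(S(ℂ); ℂ)` with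
(eR) `e` preserves rational classes, (eT) `e` preserves Hodge types, (eNS) `e` kills
`NS := algebraicClasses S 1`, (e²) `e (e x) = 2 • x` for `x ⊥ NS`.

ON THE TREE'S OWN CARRIERS, granted the four named facts every line of the route already consumes
(markings `Huybrechts_K3_marking_exists`, Grothendieck's `N¹ ⊆ F¹`, the Hodge index theorem
`hodgeIndex_surface S`, and `CupPreservesHodgeType 2 S`), the three clauses (eT), (eNS), (e²) are
satisfied on EVERY projective K3 surface by the junk endomorphism `e := c • (𝟙 - π_N)`, `c² = 2`,
`π_N` the projection onto `NS` along `NS^⊥` (`exists_nsProjection`): `exists_junk_eBlock`.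
Consequently the crux with (eR) DELETED (verbatim otherwise; INLINED as the hypothesis of
`atRankTwo_of_withoutER`, named `TwinTransportRMPicardTwoWithoutER` in the work file) is EQUIVALENT
to the parent crux `TwinTwistorTransport` restricted to Picard rank `2` (INLINED as its conclusion
= the crux with the whole `e`-block deleted, verbatim; `TwinTwistorTransportAtRankTwo` in the work
file): `atRankTwo_of_withoutER` / `withoutER_of_atRankTwo`.  So:

* any proof of the milestone that exploits real multiplication must use (eR) — the clause
  `IsRationalClass (e x)` is the ONLY one not met by `√2 · P_T` (cf. the parent's
  `Negative.withoutR_of_diagonalClass`: there too rationality is the whole content);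
* deleting (eR) does not make the item false (it stays HC-implied) but silently replaces the
  judge's 8-dimensional RM-√2 families by ALL projective K3 surfaces of Picard rank 2 (an
  18-dimensional class on which no instance of the conclusion is known either).

Refuter seat refuter-cdisprove-stmt-HodgeConjecture-15067-0 (gen 1), 2026-08-16; work file
`Cruxes/TwinTransportRMPicardTwo/Disproof.lean` §B (shadow versions B1–B4 there).
-/

noncomputable section

namespace Summit.HodgeConjecture.HodgeConjecture.Theorems.TwinTransportRMPicardTwo.Negative

open scoped Manifold
open CategoryTheory MonoidalCategory SemiCartesianMonoidalCategory
open Literature.AlgebraicGeometry.Motives Literature.AlgebraicGeometry.HodgeTheory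
open Literature.AlgebraicGeometry.Surfaces Literature.Geometry.Kaehler
open Literature.AlgebraicTopology.SingularHomology
open Summit.HodgeConjecture.HodgeConjecture.Theorems.NikulinTwinTransport

/-- **The junk `e`-block.**  On every projective K3 surface `S` (any Picard rank), granted markings,
`N¹ ⊆ F¹`, the Hodge index theorem for `S` and `CupPreservesHodgeType 2 S`, the endomorphism
`e := c • (𝟙 - π_N)` (`c * c = 2`, `π_N` the projection of `exists_nsProjection` onto
`NS = algebraicClasses S 1` along `NS^⊥`) is type-preserving, kills `NS` and satisfies
`e (e x) = 2 • x` on `NS^⊥` — clauses (eT), (eNS), (e²) of the crux — while it is NOT rational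
(`c ∉ ℚ`).  So these three clauses do not restrict `S` at all. [folklore] -/
theorem exists_junk_eBlock (hmark : Huybrechts_K3_marking_exists)
    (hG : Grothendieck1969_supportedClasses_le_hodgeConiveau) {S : SchemeOver ℂ} (hS : IsK3Surface S)
    (hHI : hodgeIndex_surface S) (hcupS : CupPreservesHodgeType 2 S) :
    ∃ e : complexBetti S (2 * 1) →ₗ[ℂ] complexBetti S (2 * 1),
      (∀ (i j : ℕ) x, IsOfHodgeType 2 S (2 * 1) i j x → IsOfHodgeType 2 S (2 * 1) i j (e x)) ∧
      (∀ d ∈ algebraicClasses S 1, e d = 0) ∧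
      (∀ x : complexBetti S (2 * 1),
        (∀ d ∈ algebraicClasses S 1, cupProduct (rfl : 2 * 1 + 2 * 1 = 2 * 2) x d = 0) →
          e (e x) = (2 : ℂ) • x) := by
  obtain ⟨η, p₀, x₀, hp₀, ⟨-, -, hηint, hηcup, -, -⟩, -⟩ := hmark S hS
  obtain ⟨A⟩ := hS.nonempty_hodgeModel
  have hN11 : ∀ d ∈ algebraicClasses S 1, IsOfHodgeType 2 S (2 * 1) 1 1 d :=
    fun d hd => isOfHodgeType_oneOne_of_mem_algebraicClasses hG hS hd
  obtain ⟨π, -, hπid, hπT, -, -, hπtype⟩ :=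
    exists_nsProjection hS η hp₀ hηint hηcup hHI A hcupS hN11
  obtain ⟨c, hc⟩ := TwinTwistorTransport.Negative.exists_complex_mul_self_eq_two
  set e : complexBetti S (2 * 1) →ₗ[ℂ] complexBetti S (2 * 1) := c • (LinearMap.id - π) with he_def
  have he : ∀ x, e x = c • (x - π x) := fun x => rfl
  refine ⟨e, ?_, ?_, ?_⟩
  · intro i j x hx
    obtain ⟨B, hB⟩ := (hπtype i j x hx).2
    refine ⟨B, ?_⟩
    rw [he, map_smul]
    exact Submodule.smul_mem _ _ hB
  · intro d hd
    rw [he, hπid d hd, sub_self, smul_zero]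
  · intro x hx
    rw [he x, hπT x hx, sub_zero, he, map_smul, hπT x hx, smul_zero, sub_zero, smul_smul, hc]

/-- **WITHOUT (eR) the crux is the parent crux at Picard rank 2** (the informative direction):
granted the four facts for every projective K3 surface, `TwinTransportRMPicardTwoWithoutER` implies
`TwinTwistorTransportAtRankTwo` — feed the junk `e`-block of `exists_junk_eBlock` to the
hypothesis. [folklore] -/
theorem atRankTwo_of_withoutER (hmark : Huybrechts_K3_marking_exists)
    (hG : Grothendieck1969_supportedClasses_le_hodgeConiveau)
    (hHI : ∀ S : SchemeOver ℂ, IsK3Surface S → hodgeIndex_surface S)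
    (hcupS : ∀ S : SchemeOver ℂ, IsK3Surface S → CupPreservesHodgeType 2 S)
    (h : ∀ (μ : Literature.AlgebraicGeometry.HodgeTheory.OrientationFamily), μ.HasPoincareDuality → ∀ (S : Literature.AlgebraicGeometry.Motives.SchemeOver ℂ) (hS : (Literature.AlgebraicGeometry.Motives.IsSmoothProjective 2 S ∧ Subsingleton (Literature.AlgebraicGeometry.Motives.structureSheafCohomology S.left 1) ∧ ∃ (A : Literature.AlgebraicGeometry.HodgeTheory.HodgeModel 2 S) (η : Literature.Geometry.Kaehler.MForm 𝓘(ℝ, A.model) A.carrier ℂ 2), Literature.Geometry.Kaehler.IsHolomorphicInCharts η ∧ ∀ x, η x ≠ 0)) (p : Literature.AlgebraicGeometry.HodgeTheory.complexBetti S (2 * 2)), (Literature.AlgebraicGeometry.HodgeTheory.IsIntegralClass p ∧ ∀ q : Literature.AlgebraicGeometry.HodgeTheory.complexBetti S (2 * 2), Literature.AlgebraicGeometry.HodgeTheory.IsIntegralClass q → ∃ n : ℤ, q = n • p) → Module.finrank ℂ ↥(Literature.AlgebraicGeometry.HodgeTheory.algebraicClasses S 1) = 2 → ∀ (e : Literature.AlgebraicGeometry.HodgeTheory.complexBetti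 S (2 * 1) →ₗ[ℂ] Literature.AlgebraicGeometry.HodgeTheory.complexBetti S (2 * 1)), (∀ (i j : ℕ) x, Literature.AlgebraicGeometry.HodgeTheory.IsOfHodgeType 2 S (2 * 1) i j x → Literature.AlgebraicGeometry.HodgeTheory.IsOfHodgeType 2 S (2 * 1) i j (e x)) → (∀ d ∈ Literature.AlgebraicGeometry.HodgeTheory.algebraicClasses S 1, e d = 0) → (∀ x : Literature.AlgebraicGeometry.HodgeTheory.complexBetti S (2 * 1), (∀ d ∈ Literature.AlgebraicGeometry.HodgeTheory.algebraicClasses S 1, Literature.AlgebraicTopology.SingularHomology.cupProduct (rfl : 2 * 1 + 2 * 1 = 2 * 2) x d = 0) → e (e x) = (2 : ℂ) • x) → ∃ (S'' : Literature.AlgebraicGeometry.Motives.SchemeOver ℂ) (hS'' : (Literature.AlgebraicGeometry.Motives.IsSmoothProjective 2 S'' ∧ Subsingleton (Literature.AlgebraicGeometry.Motives.structureSheafCohomology S''.left 1) ∧ ∃ (A : Literature.AlgebraicGeometry.HodgeTheory.HodgeModel 2 S'') (η : Literature.Geometry.Kaehler.MForm 𝓘(ℝ, A.model) A.carrier ℂ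 2), Literature.Geometry.Kaehler.IsHolomorphicInCharts η ∧ ∀ x, η x ≠ 0)) (p'' : Literature.AlgebraicGeometry.HodgeTheory.complexBetti S'' (2 * 2)), (Literature.AlgebraicGeometry.HodgeTheory.IsIntegralClass p'' ∧ ∀ q : Literature.AlgebraicGeometry.HodgeTheory.complexBetti S'' (2 * 2), Literature.AlgebraicGeometry.HodgeTheory.IsIntegralClass q → ∃ n : ℤ, q = n • p'') ∧ ∃ Ψ : Literature.AlgebraicGeometry.HodgeTheory.complexBetti S'' (2 * 1) ≃ₗ[ℂ] Literature.AlgebraicGeometry.HodgeTheory.complexBetti S (2 * 1), (∀ y, Literature.AlgebraicGeometry.HodgeTheory.IsRationalClass y → Literature.AlgebraicGeometry.HodgeTheory.IsRationalClass (Ψ.symm y)) ∧ (∀ (i j : ℕ) y, Literature.AlgebraicGeometry.HodgeTheory.IsOfHodgeType 2 S (2 * 1) i j y → Literature.AlgebraicGeometry.HodgeTheory.IsOfHodgeType 2 S'' (2 * 1) i j (Ψ.symm y)) ∧ (∀ (u v : Literature.AlgebraicGeometry.HodgeTheory.complexBetti S (2 * 1)) (b : ℂ), Literature.AlgebraicTopology.SingularHomology.cupProduct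 (rfl : 2 * 1 + 2 * 1 = 2 * 2) u v = ((2 : ℂ) * b) • p → Literature.AlgebraicTopology.SingularHomology.cupProduct (rfl : 2 * 1 + 2 * 1 = 2 * 2) (Ψ.symm u) (Ψ.symm v) = b • p'') ∧ ∃ γ ∈ Literature.AlgebraicGeometry.HodgeTheory.algebraicClasses (CategoryTheory.MonoidalCategoryStruct.tensorObj S S'') 2, ∀ x : Literature.AlgebraicGeometry.HodgeTheory.complexBetti S'' (2 * 1), Ψ x = Literature.AlgebraicGeometry.HodgeTheory.complexGysin μ (Literature.AlgebraicGeometry.Motives.IsSmoothProjective.tensor_holds hS.1 hS''.1) hS.1 (CategoryTheory.SemiCartesianMonoidalCategory.fst S S'') (rfl : 2 * 1 + 2 * 2 + 2 * 2 = 2 * 1 + 2 * (2 + 2)) (Literature.AlgebraicTopology.SingularHomology.cupProduct (rfl : 2 * 1 + 2 * 2 = 2 * 1 + 2 * 2) (Literature.AlgebraicGeometry.HodgeTheory.complexBetti.map (CategoryTheory.SemiCartesianMonoidalCategory.snd S S'') (2 * 1) x) γ)) :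
    ∀ (μ : Literature.AlgebraicGeometry.HodgeTheory.OrientationFamily), μ.HasPoincareDuality → ∀ (S : Literature.AlgebraicGeometry.Motives.SchemeOver ℂ) (hS : (Literature.AlgebraicGeometry.Motives.IsSmoothProjective 2 S ∧ Subsingleton (Literature.AlgebraicGeometry.Motives.structureSheafCohomology S.left 1) ∧ ∃ (A : Literature.AlgebraicGeometry.HodgeTheory.HodgeModel 2 S) (η : Literature.Geometry.Kaehler.MForm 𝓘(ℝ, A.model) A.carrier ℂ 2), Literature.Geometry.Kaehler.IsHolomorphicInCharts η ∧ ∀ x, η x ≠ 0)) (p : Literature.AlgebraicGeometry.HodgeTheory.complexBetti S (2 * 2)), (Literature.AlgebraicGeometry.HodgeTheory.IsIntegralClass p ∧ ∀ q : Literature.AlgebraicGeometry.HodgeTheory.complexBetti S (2 * 2), Literature.AlgebraicGeometry.HodgeTheory.IsIntegralClass q → ∃ n : ℤ, q = n • p) → Module.finrank ℂ ↥(Literature.AlgebraicGeometry.HodgeTheory.algebraicClasses S 1) = 2 → ∃ (S'' : Literature.AlgebraicGeometry.Motives.SchemeOver ℂ) (hS'' : (Literature.AlgebraicGeometry.Motives.IsSmoothProjective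 2 S'' ∧ Subsingleton (Literature.AlgebraicGeometry.Motives.structureSheafCohomology S''.left 1) ∧ ∃ (A : Literature.AlgebraicGeometry.HodgeTheory.HodgeModel 2 S'') (η : Literature.Geometry.Kaehler.MForm 𝓘(ℝ, A.model) A.carrier ℂ 2), Literature.Geometry.Kaehler.IsHolomorphicInCharts η ∧ ∀ x, η x ≠ 0)) (p'' : Literature.AlgebraicGeometry.HodgeTheory.complexBetti S'' (2 * 2)), (Literature.AlgebraicGeometry.HodgeTheory.IsIntegralClass p'' ∧ ∀ q : Literature.AlgebraicGeometry.HodgeTheory.complexBetti S'' (2 * 2), Literature.AlgebraicGeometry.HodgeTheory.IsIntegralClass q → ∃ n : ℤ, q = n • p'') ∧ ∃ Ψ : Literature.AlgebraicGeometry.HodgeTheory.complexBetti S'' (2 * 1) ≃ₗ[ℂ] Literature.AlgebraicGeometry.HodgeTheory.complexBetti S (2 * 1), (∀ y, Literature.AlgebraicGeometry.HodgeTheory.IsRationalClass y → Literature.AlgebraicGeometry.HodgeTheory.IsRationalClass (Ψ.symm y)) ∧ (∀ (i j : ℕ) y, Literature.AlgebraicGeometry.HodgeTheory.IsOfHodgeType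 2 S (2 * 1) i j y → Literature.AlgebraicGeometry.HodgeTheory.IsOfHodgeType 2 S'' (2 * 1) i j (Ψ.symm y)) ∧ (∀ (u v : Literature.AlgebraicGeometry.HodgeTheory.complexBetti S (2 * 1)) (b : ℂ), Literature.AlgebraicTopology.SingularHomology.cupProduct (rfl : 2 * 1 + 2 * 1 = 2 * 2) u v = ((2 : ℂ) * b) • p → Literature.AlgebraicTopology.SingularHomology.cupProduct (rfl : 2 * 1 + 2 * 1 = 2 * 2) (Ψ.symm u) (Ψ.symm v) = b • p'') ∧ ∃ γ ∈ Literature.AlgebraicGeometry.HodgeTheory.algebraicClasses (CategoryTheory.MonoidalCategoryStruct.tensorObj S S'') 2, ∀ x : Literature.AlgebraicGeometry.HodgeTheory.complexBetti S'' (2 * 1), Ψ x = Literature.AlgebraicGeometry.HodgeTheory.complexGysin μ (Literature.AlgebraicGeometry.Motives.IsSmoothProjective.tensor_holds hS.1 hS''.1) hS.1 (CategoryTheory.SemiCartesianMonoidalCategory.fst S S'') (rfl : 2 * 1 + 2 * 2 + 2 * 2 = 2 * 1 + 2 * (2 + 2)) (Literature.AlgebraicTopology.SingularHomology.cupProduct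 (rfl : 2 * 1 + 2 * 2 = 2 * 1 + 2 * 2) (Literature.AlgebraicGeometry.HodgeTheory.complexBetti.map (CategoryTheory.SemiCartesianMonoidalCategory.snd S S'') (2 * 1) x) γ) := by
  intro μ hμ S hS p hp hrank
  obtain ⟨e, he_type, he_N, he_T⟩ := exists_junk_eBlock hmark hG hS (hHI S hS) (hcupS S hS)
  exact h μ hμ S hS p hp hrank e he_type he_N he_T

/-- The converse direction is bookkeeping: the parent crux at rank 2 ignores `e`. [folklore] -/
theorem withoutER_of_atRankTwo
    (h : ∀ (μ : Literature.AlgebraicGeometry.HodgeTheory.OrientationFamily), μ.HasPoincareDuality → ∀ (S : Literature.AlgebraicGeometry.Motives.SchemeOver ℂ) (hS : (Literature.AlgebraicGeometry.Motives.IsSmoothProjective 2 S ∧ Subsingleton (Literature.AlgebraicGeometry.Motives.structureSheafCohomology S.left 1) ∧ ∃ (A : Literature.AlgebraicGeometry.HodgeTheory.HodgeModel 2 S) (η : Literature.Geometry.Kaehler.MForm 𝓘(ℝ, A.model) A.carrier ℂ 2), Literature.Geometry.Kaehler.IsHolomorphicInCharts η ∧ ∀ x, η x ≠ 0)) (p :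 Literature.AlgebraicGeometry.HodgeTheory.complexBetti S (2 * 2)), (Literature.AlgebraicGeometry.HodgeTheory.IsIntegralClass p ∧ ∀ q : Literature.AlgebraicGeometry.HodgeTheory.complexBetti S (2 * 2), Literature.AlgebraicGeometry.HodgeTheory.IsIntegralClass q → ∃ n : ℤ, q = n • p) → Module.finrank ℂ ↥(Literature.AlgebraicGeometry.HodgeTheory.algebraicClasses S 1) = 2 → ∃ (S'' : Literature.AlgebraicGeometry.Motives.SchemeOver ℂ) (hS'' : (Literature.AlgebraicGeometry.Motives.IsSmoothProjective 2 S'' ∧ Subsingleton (Literature.AlgebraicGeometry.Motives.structureSheafCohomology S''.left 1) ∧ ∃ (A : Literature.AlgebraicGeometry.HodgeTheory.HodgeModel 2 S'') (η : Literature.Geometry.Kaehler.MForm 𝓘(ℝ, A.model) A.carrier ℂ 2), Literature.Geometry.Kaehler.IsHolomorphicInCharts η ∧ ∀ x, η x ≠ 0)) (p'' : Literature.AlgebraicGeometry.HodgeTheory.complexBetti S'' (2 * 2)), (Literature.AlgebraicGeometry.HodgeTheory.IsIntegralClass p'' ∧ ∀ q : Literature.AlgebraicGeometry.HodgeTheory.complexBetti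 S'' (2 * 2), Literature.AlgebraicGeometry.HodgeTheory.IsIntegralClass q → ∃ n : ℤ, q = n • p'') ∧ ∃ Ψ : Literature.AlgebraicGeometry.HodgeTheory.complexBetti S'' (2 * 1) ≃ₗ[ℂ] Literature.AlgebraicGeometry.HodgeTheory.complexBetti S (2 * 1), (∀ y, Literature.AlgebraicGeometry.HodgeTheory.IsRationalClass y → Literature.AlgebraicGeometry.HodgeTheory.IsRationalClass (Ψ.symm y)) ∧ (∀ (i j : ℕ) y, Literature.AlgebraicGeometry.HodgeTheory.IsOfHodgeType 2 S (2 * 1) i j y → Literature.AlgebraicGeometry.HodgeTheory.IsOfHodgeType 2 S'' (2 * 1) i j (Ψ.symm y)) ∧ (∀ (u v : Literature.AlgebraicGeometry.HodgeTheory.complexBetti S (2 * 1)) (b : ℂ), Literature.AlgebraicTopology.SingularHomology.cupProduct (rfl : 2 * 1 + 2 * 1 = 2 * 2) u v = ((2 : ℂ) * b) • p → Literature.AlgebraicTopology.SingularHomology.cupProduct (rfl : 2 * 1 + 2 * 1 = 2 * 2) (Ψ.symm u) (Ψ.symm v) = b • p'') ∧ ∃ γ ∈ Literature.AlgebraicGeometry.HodgeTheory.algebraicClasses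 (CategoryTheory.MonoidalCategoryStruct.tensorObj S S'') 2, ∀ x : Literature.AlgebraicGeometry.HodgeTheory.complexBetti S'' (2 * 1), Ψ x = Literature.AlgebraicGeometry.HodgeTheory.complexGysin μ (Literature.AlgebraicGeometry.Motives.IsSmoothProjective.tensor_holds hS.1 hS''.1) hS.1 (CategoryTheory.SemiCartesianMonoidalCategory.fst S S'') (rfl : 2 * 1 + 2 * 2 + 2 * 2 = 2 * 1 + 2 * (2 + 2)) (Literature.AlgebraicTopology.SingularHomology.cupProduct (rfl : 2 * 1 + 2 * 2 = 2 * 1 + 2 * 2) (Literature.AlgebraicGeometry.HodgeTheory.complexBetti.map (CategoryTheory.SemiCartesianMonoidalCategory.snd S S'') (2 * 1) x) γ)) :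
    ∀ (μ : Literature.AlgebraicGeometry.HodgeTheory.OrientationFamily), μ.HasPoincareDuality → ∀ (S : Literature.AlgebraicGeometry.Motives.SchemeOver ℂ) (hS : (Literature.AlgebraicGeometry.Motives.IsSmoothProjective 2 S ∧ Subsingleton (Literature.AlgebraicGeometry.Motives.structureSheafCohomology S.left 1) ∧ ∃ (A : Literature.AlgebraicGeometry.HodgeTheory.HodgeModel 2 S) (η : Literature.Geometry.Kaehler.MForm 𝓘(ℝ, A.model) A.carrier ℂ 2), Literature.Geometry.Kaehler.IsHolomorphicInCharts η ∧ ∀ x, η x ≠ 0)) (p : Literature.AlgebraicGeometry.HodgeTheory.complexBetti S (2 * 2)), (Literature.AlgebraicGeometry.HodgeTheory.IsIntegralClass p ∧ ∀ q : Literature.AlgebraicGeometry.HodgeTheory.complexBetti S (2 * 2), Literature.AlgebraicGeometry.HodgeTheory.IsIntegralClass q → ∃ n : ℤ, q = n • p) → Module.finrank ℂ ↥(Literature.AlgebraicGeometry.HodgeTheory.algebraicClasses S 1) = 2 → ∀ (e : Literature.AlgebraicGeometry.HodgeTheory.complexBetti S (2 * 1) →ₗ[ℂ] Literature.AlgebraicGeometry.HodgeTheory.complexBetti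 S (2 * 1)), (∀ (i j : ℕ) x, Literature.AlgebraicGeometry.HodgeTheory.IsOfHodgeType 2 S (2 * 1) i j x → Literature.AlgebraicGeometry.HodgeTheory.IsOfHodgeType 2 S (2 * 1) i j (e x)) → (∀ d ∈ Literature.AlgebraicGeometry.HodgeTheory.algebraicClasses S 1, e d = 0) → (∀ x : Literature.AlgebraicGeometry.HodgeTheory.complexBetti S (2 * 1), (∀ d ∈ Literature.AlgebraicGeometry.HodgeTheory.algebraicClasses S 1, Literature.AlgebraicTopology.SingularHomology.cupProduct (rfl : 2 * 1 + 2 * 1 = 2 * 2) x d = 0) → e (e x) = (2 : ℂ) • x) → ∃ (S'' : Literature.AlgebraicGeometry.Motives.SchemeOver ℂ) (hS'' : (Literature.AlgebraicGeometry.Motives.IsSmoothProjective 2 S'' ∧ Subsingleton (Literature.AlgebraicGeometry.Motives.structureSheafCohomology S''.left 1) ∧ ∃ (A : Literature.AlgebraicGeometry.HodgeTheory.HodgeModel 2 S'') (η : Literature.Geometry.Kaehler.MForm 𝓘(ℝ, A.model) A.carrier ℂ 2), Literature.Geometry.Kaehler.IsHolomorphicInCharts η ∧ ∀ x, η x ≠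 0)) (p'' : Literature.AlgebraicGeometry.HodgeTheory.complexBetti S'' (2 * 2)), (Literature.AlgebraicGeometry.HodgeTheory.IsIntegralClass p'' ∧ ∀ q : Literature.AlgebraicGeometry.HodgeTheory.complexBetti S'' (2 * 2), Literature.AlgebraicGeometry.HodgeTheory.IsIntegralClass q → ∃ n : ℤ, q = n • p'') ∧ ∃ Ψ : Literature.AlgebraicGeometry.HodgeTheory.complexBetti S'' (2 * 1) ≃ₗ[ℂ] Literature.AlgebraicGeometry.HodgeTheory.complexBetti S (2 * 1), (∀ y, Literature.AlgebraicGeometry.HodgeTheory.IsRationalClass y → Literature.AlgebraicGeometry.HodgeTheory.IsRationalClass (Ψ.symm y)) ∧ (∀ (i j : ℕ) y, Literature.AlgebraicGeometry.HodgeTheory.IsOfHodgeType 2 S (2 * 1) i j y → Literature.AlgebraicGeometry.HodgeTheory.IsOfHodgeType 2 S'' (2 * 1) i j (Ψ.symm y)) ∧ (∀ (u v : Literature.AlgebraicGeometry.HodgeTheory.complexBetti S (2 * 1)) (b : ℂ), Literature.AlgebraicTopology.SingularHomology.cupProduct (rfl : 2 * 1 + 2 * 1 = 2 * 2) u v = ((2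 : ℂ) * b) • p → Literature.AlgebraicTopology.SingularHomology.cupProduct (rfl : 2 * 1 + 2 * 1 = 2 * 2) (Ψ.symm u) (Ψ.symm v) = b • p'') ∧ ∃ γ ∈ Literature.AlgebraicGeometry.HodgeTheory.algebraicClasses (CategoryTheory.MonoidalCategoryStruct.tensorObj S S'') 2, ∀ x : Literature.AlgebraicGeometry.HodgeTheory.complexBetti S'' (2 * 1), Ψ x = Literature.AlgebraicGeometry.HodgeTheory.complexGysin μ (Literature.AlgebraicGeometry.Motives.IsSmoothProjective.tensor_holds hS.1 hS''.1) hS.1 (CategoryTheory.SemiCartesianMonoidalCategory.fst S S'') (rfl : 2 * 1 + 2 * 2 + 2 * 2 = 2 * 1 + 2 * (2 + 2)) (Literature.AlgebraicTopology.SingularHomology.cupProduct (rfl : 2 * 1 + 2 * 2 = 2 * 1 + 2 * 2) (Literature.AlgebraicGeometry.HodgeTheory.complexBetti.map (CategoryTheory.SemiCartesianMonoidalCategory.snd S S'') (2 * 1) x) γ) :=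
  fun μ hμ S hS p hp hrank _ _ _ _ => h μ hμ S hS p hp hrank

/-- And the parent crux itself implies its rank-2 restriction (so, with the two theorems above,
`TwinTwistorTransport ⟹ TwinTransportRMPicardTwoWithoutER ⟺ TwinTwistorTransportAtRankTwo`
modulo the facts). [folklore] -/
theorem atRankTwo_of_twinTwistorTransport (h : Theses.NikulinTwinTransport.TwinTwistorTransport) :
    ∀ (μ : Literature.AlgebraicGeometry.HodgeTheory.OrientationFamily), μ.HasPoincareDuality → ∀ (S : Literature.AlgebraicGeometry.Motives.SchemeOver ℂ) (hS : (Literature.AlgebraicGeometry.Motives.IsSmoothProjective 2 S ∧ Subsingleton (Literature.AlgebraicGeometry.Motives.structureSheafCohomology S.left 1) ∧ ∃ (A : Literature.AlgebraicGeometry.HodgeTheory.HodgeModel 2 S) (η : Literature.Geometry.Kaehler.MForm 𝓘(ℝ, A.model) A.carrier ℂ 2), Literature.Geometry.Kaehler.IsHolomorphicInCharts η ∧ ∀ x, η x ≠ 0)) (p : Literature.AlgebraicGeometry.HodgeTheory.complexBetti S (2 * 2)), (Literature.AlgebraicGeometry.HodgeTheory.IsIntegralClass p ∧ ∀ q : Literature.AlgebraicGeometry.HodgeTheory.complexBetti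 S (2 * 2), Literature.AlgebraicGeometry.HodgeTheory.IsIntegralClass q → ∃ n : ℤ, q = n • p) → Module.finrank ℂ ↥(Literature.AlgebraicGeometry.HodgeTheory.algebraicClasses S 1) = 2 → ∃ (S'' : Literature.AlgebraicGeometry.Motives.SchemeOver ℂ) (hS'' : (Literature.AlgebraicGeometry.Motives.IsSmoothProjective 2 S'' ∧ Subsingleton (Literature.AlgebraicGeometry.Motives.structureSheafCohomology S''.left 1) ∧ ∃ (A : Literature.AlgebraicGeometry.HodgeTheory.HodgeModel 2 S'') (η : Literature.Geometry.Kaehler.MForm 𝓘(ℝ, A.model) A.carrier ℂ 2), Literature.Geometry.Kaehler.IsHolomorphicInCharts η ∧ ∀ x, η x ≠ 0)) (p'' : Literature.AlgebraicGeometry.HodgeTheory.complexBetti S'' (2 * 2)), (Literature.AlgebraicGeometry.HodgeTheory.IsIntegralClass p'' ∧ ∀ q : Literature.AlgebraicGeometry.HodgeTheory.complexBetti S'' (2 * 2), Literature.AlgebraicGeometry.HodgeTheory.IsIntegralClass q → ∃ n : ℤ, q = n • p'') ∧ ∃ Ψ : Literature.AlgebraicGeometry.HodgeTheory.complexBetti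 S'' (2 * 1) ≃ₗ[ℂ] Literature.AlgebraicGeometry.HodgeTheory.complexBetti S (2 * 1), (∀ y, Literature.AlgebraicGeometry.HodgeTheory.IsRationalClass y → Literature.AlgebraicGeometry.HodgeTheory.IsRationalClass (Ψ.symm y)) ∧ (∀ (i j : ℕ) y, Literature.AlgebraicGeometry.HodgeTheory.IsOfHodgeType 2 S (2 * 1) i j y → Literature.AlgebraicGeometry.HodgeTheory.IsOfHodgeType 2 S'' (2 * 1) i j (Ψ.symm y)) ∧ (∀ (u v : Literature.AlgebraicGeometry.HodgeTheory.complexBetti S (2 * 1)) (b : ℂ), Literature.AlgebraicTopology.SingularHomology.cupProduct (rfl : 2 * 1 + 2 * 1 = 2 * 2) u v = ((2 : ℂ) * b) • p → Literature.AlgebraicTopology.SingularHomology.cupProduct (rfl : 2 * 1 + 2 * 1 = 2 * 2) (Ψ.symm u) (Ψ.symm v) = b • p'') ∧ ∃ γ ∈ Literature.AlgebraicGeometry.HodgeTheory.algebraicClasses (CategoryTheory.MonoidalCategoryStruct.tensorObj S S'') 2, ∀ x : Literature.AlgebraicGeometry.HodgeTheory.complexBetti S'' (2 * 1), Ψ x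 = Literature.AlgebraicGeometry.HodgeTheory.complexGysin μ (Literature.AlgebraicGeometry.Motives.IsSmoothProjective.tensor_holds hS.1 hS''.1) hS.1 (CategoryTheory.SemiCartesianMonoidalCategory.fst S S'') (rfl : 2 * 1 + 2 * 2 + 2 * 2 = 2 * 1 + 2 * (2 + 2)) (Literature.AlgebraicTopology.SingularHomology.cupProduct (rfl : 2 * 1 + 2 * 2 = 2 * 1 + 2 * 2) (Literature.AlgebraicGeometry.HodgeTheory.complexBetti.map (CategoryTheory.SemiCartesianMonoidalCategory.snd S S'') (2 * 1) x) γ) :=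
  fun μ hμ S hS p hp _ => h μ hμ S hS p hp

end Summit.HodgeConjecture.HodgeConjecture.Theorems.TwinTransportRMPicardTwo.Negative

end
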